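import Literature.NumberTheory.LFunctions.GRHTwistedCharacterPrimeSums
import HarnessLib

/-!
# Twisted prime sums under GRH: from `ψ(x, χ, t)` to `∑_{p ≤ x} χ(p) p^{-it}` and to `∑ χ(p) p^{-s}`

Topic `Literature/NumberTheory/LFunctions`. THEOREMS (everything proved). Consequences of the
twisted form of Montgomery–Vaughan (13.19) (`GRHTwistedPrimeSum.exists_norm_twistedPsi_le`) for a
primitive character `χ` mod `q > 1` satisfying the Riemann hypothesis, uniformly in real `t`:

* `exists_norm_twistedTheta_le` — (13.20) twisted: `|∑_{p ≤ n} χ(p) p^{-it} log p| ≪ √n log n log(q(|t|+2)n)`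
  (`ψ − ϑ ≤ 2√x log x`, Mathlib `Chebyshev.psi_sub_theta_le`);
* `exists_norm_twistedPi_le` — (13.21) twisted: `|∑_{p ≤ N} χ(p) p^{-it}| ≤ B √N log(q(|t|+2)N)`
  (partial summation, the tree's `GRHPrimeCharSum.norm_primeSum_le_of_theta`);
* `norm_sum_Ioc_prime_mul_rpow_le` — a second partial summation (Mathlib's Abel summation
  `sum_mul_eq_sub_sub_integral_mul` with `f(u) = u^{-σ}`): if `|∑_{p ≤ N} a_p| ≤ B √N log(rN)` for
  all `N`, then for `σ ≥ 1/2 + ε`, `2 ≤ U ≤ y`,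
  `|∑_{U < p ≤ y} a_p p^{-σ}| ≤ B (log r) U^{-ε} (2 + σ/ε) + B (2/ε + 4σ/ε²)`:
  the coefficient of `log r = log q(|t| + 2)` tends to `0` with `U`, which is what gives the
  Lindelöf-type bound for `L(s, χ; y)` under GRH (`GRHSmoothEulerProductLindelof.lean`,
  Lagarias–Soundararajan 2012, Prop. 5.1).

## References

* H. L. Montgomery, R. C. Vaughan, *Multiplicative Number Theory I. Classical Theory*, CUP 2007,
  §13.1, Theorem 13.7 ((13.19)–(13.21)). [MontgomeryVaughan2007]
-/

noncomputable section

open Complex Filter Topology Set MeasureTheory intervalIntegral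
open scoped Real ArithmeticFunction.vonMangoldt

namespace Literature.NumberTheory.LFunctions

namespace GRHTwistedPrimeSum

open DirichletCharacter ExplicitPsiChar GRHPrimeCharSum

/-! ### From `ψ(x, χ, t)` to the sum over primes -/

/-- `‖ψ(N, χ, t) − ϑ(N, χ, t)‖ ≤ ψ(N) − ϑ(N) ≤ 2√N log N`, where
`ϑ(N, χ, t) = ∑_{p ≤ N} χ(p) p^{-it} log p`. [cite: MontgomeryVaughan2007, Theorem 13.7 (13.20)] -/
theorem norm_twistedPsi_sub_theta_le {q : ℕ} (χ : DirichletCharacter ℂ q) (t : ℝ) {N : ℕ} (hN : 1 ≤ N) :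
    ‖∑ n ∈ Finset.range (N + 1), χ n * Λ n * (n : ℂ) ^ (-(t * I)) -
        ∑ p ∈ (Finset.Icc 0 N).filter Nat.Prime, χ p * (p : ℂ) ^ (-(t * I)) * (Real.log p : ℂ)‖ ≤
      2 * Real.sqrt N * Real.log N := by
  classical
  rw [Nat.range_succ_eq_Icc_zero]
  have hsplit := (Finset.sum_filter_add_sum_filter_not (Finset.Icc 0 N) Nat.Prime
    (fun n ↦ χ n * Λ n * (n : ℂ) ^ (-(t * I)))).symm
  have hprime : ∑ n ∈ (Finset.Icc 0 N).filter Nat.Prime, χ n * Λ n * (n : ℂ) ^ (-(t * I)) =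
      ∑ p ∈ (Finset.Icc 0 N).filter Nat.Prime, χ p * (p : ℂ) ^ (-(t * I)) * (Real.log p : ℂ) := by
    refine Finset.sum_congr rfl fun p hp ↦ ?_
    rw [ArithmeticFunction.vonMangoldt_apply_prime (Finset.mem_filter.1 hp).2]; ring
  have hpsi : Chebyshev.psi N - Chebyshev.theta N =
      ∑ n ∈ (Finset.Icc 0 N).filter (fun n ↦ ¬n.Prime), (Λ n : ℝ) := by
    rw [Chebyshev.psi_eq_sum_Icc, Chebyshev.theta_eq_sum_Icc, Nat.floor_natCast, Finset.sum_filter,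
      Finset.sum_filter, ← Finset.sum_sub_distrib]
    refine Finset.sum_congr rfl fun n _ ↦ ?_
    split_ifs with h
    · simp [ArithmeticFunction.vonMangoldt_apply_prime h]
    · simp
  rw [hsplit, hprime, add_sub_cancel_left]
  have hN1 : (1 : ℝ) ≤ N := by exact_mod_cast hN
  calc ‖∑ n ∈ (Finset.Icc 0 N).filter (fun n ↦ ¬n.Prime), χ n * Λ n * (n : ℂ) ^ (-(t * I))‖
      ≤ ∑ n ∈ (Finset.Icc 0 N).filter (fun n ↦ ¬n.Prime), ‖χ n * Λ n * (n : ℂ) ^ (-(t * I))‖ :=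
        norm_sum_le _ _
    _ ≤ ∑ n ∈ (Finset.Icc 0 N).filter (fun n ↦ ¬n.Prime), (Λ n : ℝ) :=
        Finset.sum_le_sum fun n _ ↦ norm_twistTerm_le χ t n
    _ = Chebyshev.psi N - Chebyshev.theta N := hpsi.symm
    _ ≤ 2 * Real.sqrt N * Real.log N := Chebyshev.psi_sub_theta_le hN1

/-- **Twisted (13.20) under RH.** There is an absolute `A' > 0` with
`‖∑_{p ≤ n} χ(p) p^{-it} log p‖ ≤ A' √n (log n) log(q(|t| + 2)n)` for every `q > 1`, primitive
`χ` mod `q` with RH, real `t` and `n ≥ 2`. [cite: MontgomeryVaughan2007, Theorem 13.7 (13.20)] -/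
theorem exists_norm_twistedTheta_le :
    ∃ A' : ℝ, 0 < A' ∧ ∀ (q : ℕ) [NeZero q] (χ : DirichletCharacter ℂ q), χ.IsPrimitive → 1 < q →
      χ.RiemannHypothesis → ∀ (t : ℝ) (n : ℕ), 2 ≤ n →
        ‖∑ p ∈ (Finset.Icc 0 n).filter Nat.Prime, χ p * (p : ℂ) ^ (-(t * I)) * (Real.log p : ℂ)‖ ≤
          A' * Real.sqrt n * Real.log n * Real.log (q * (|t| + 2) * n) := by
  obtain ⟨A, hA0, hA⟩ := exists_norm_twistedPsi_le
  refine ⟨A + 2, by positivity, fun q _ χ hprim hq hRH t n hn ↦ ?_⟩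
  have hnr : (2 : ℝ) ≤ n := by exact_mod_cast hn
  have hq2 : (2 : ℝ) ≤ q := by exact_mod_cast hq
  have hψ := hA q χ hprim hq hRH t n hnr
  rw [Nat.floor_natCast] at hψ
  have hψθ := norm_twistedPsi_sub_theta_le χ t (by omega : 1 ≤ n)
  have hlog0 : 0 ≤ Real.log n := Real.log_nonneg (by linarith)
  have hlog1 : 1 ≤ Real.log (q * (|t| + 2) * n) := by
    rw [Real.le_log_iff_exp_le (by positivity)]
    have h3 : Real.exp 1 ≤ 2 * 2 * 2 := by linarith [Real.exp_one_lt_d9]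
    have h4 : (2 : ℝ) * 2 ≤ q * (|t| + 2) := mul_le_mul hq2 (by linarith [abs_nonneg t]) (by norm_num) (by linarith)
    exact h3.trans (mul_le_mul h4 hnr (by norm_num) (by positivity))
  have hextra : 2 * Real.sqrt n * Real.log n ≤ 2 * Real.sqrt n * Real.log n * Real.log (q * (|t| + 2) * n) :=
    le_mul_of_one_le_right (by positivity) hlog1
  have e := norm_sub_le (∑ p ∈ (Finset.Icc 0 n).filter Nat.Prime, χ p * (p : ℂ) ^ (-(t * I)) * (Real.log p : ℂ))
    (∑ k ∈ Finset.range (n + 1), χ k * Λ k * (k : ℂ) ^ (-(t * I)))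
  rw [norm_sub_rev] at hψθ
  have e2 := norm_add_le
    (∑ p ∈ (Finset.Icc 0 n).filter Nat.Prime, χ p * (p : ℂ) ^ (-(t * I)) * (Real.log p : ℂ) -
      ∑ k ∈ Finset.range (n + 1), χ k * Λ k * (k : ℂ) ^ (-(t * I)))
    (∑ k ∈ Finset.range (n + 1), χ k * Λ k * (k : ℂ) ^ (-(t * I)))
  rw [sub_add_cancel] at e2
  calc _ ≤ 2 * Real.sqrt n * Real.log n * Real.log (q * (|t| + 2) * n) +
        A * Real.sqrt n * Real.log n * Real.log (q * (|t| + 2) * n) := by linarith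
    _ = (A + 2) * Real.sqrt n * Real.log n * Real.log (q * (|t| + 2) * n) := by ring

/-- **Twisted (13.21) under RH.** There is an absolute `B > 0` such that for every `q > 1`, every
primitive `χ` mod `q` with RH, every real `t` and EVERY `N : ℕ`,
`‖∑_{p ≤ N} χ(p) p^{-it}‖ ≤ B √N log(q(|t| + 2)N)` (for `N ≤ 1` both sides vanish or the left
one does). [cite: MontgomeryVaughan2007, Theorem 13.7 (13.21)] -/
theorem exists_norm_twistedPi_le :
    ∃ B : ℝ, 0 < B ∧ ∀ (q : ℕ) [NeZero q] (χ : DirichletCharacter ℂ q), χ.IsPrimitive → 1 < q →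
      χ.RiemannHypothesis → ∀ (t : ℝ) (N : ℕ),
        ‖∑ p ∈ (Finset.Icc 0 N).filter Nat.Prime, χ p * (p : ℂ) ^ (-(t * I))‖ ≤
          B * Real.sqrt N * Real.log (q * (|t| + 2) * N) := by
  obtain ⟨A', hA'0, hA'⟩ := exists_norm_twistedTheta_le
  refine ⟨3 * A', by positivity, fun q _ χ hprim hq hRH t N ↦ ?_⟩
  have hq2 : (2 : ℝ) ≤ q := by exact_mod_cast hq
  have hr : (1 : ℝ) ≤ q * (|t| + 2) := one_le_mul_of_one_le_of_one_le (by linarith) (by linarith [abs_nonneg t])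
  rcases lt_or_ge N 2 with hN | hN
  · -- no primes `≤ 1`
    have h0 : ∑ p ∈ (Finset.Icc 0 N).filter Nat.Prime, χ p * (p : ℂ) ^ (-(t * I)) = 0 := by
      refine Finset.sum_eq_zero fun p hp ↦ ?_
      obtain ⟨hp1, hp2⟩ := Finset.mem_filter.1 hp
      have : p ≤ N := (Finset.mem_Icc.1 hp1).2
      exact absurd hp2.two_le (by omega)
    rw [h0, norm_zero]
    rcases Nat.lt_succ_iff.1 hN |>.eq_or_lt with rfl | h0N
    · have : 0 ≤ Real.log (q * (|t| + 2) * (1 : ℕ)) := Real.log_nonneg (by simpa using hr)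
      positivity
    · have hN0 : N = 0 := by omega
      subst hN0
      simp
  · have h := norm_primeSum_le_of_theta (fun p ↦ χ p * (p : ℂ) ^ (-(t * I))) hA'0.le hr
      (fun n hn ↦ hA' q χ hprim hq hRH t n hn) hN
    calc _ ≤ 3 * A' * Real.sqrt N * Real.log (q * (|t| + 2) * N) := h
      _ = _ := by ring

/-! ### Partial summation with the weights `p^{-σ}` -/

/-- **Second partial summation.** If `‖∑_{p ≤ N} a_p‖ ≤ B √N log(rN)` for all `N` (`B ≥ 0`,
`r ≥ 1`), then for `0 < ε`, `σ ≥ 1/2 + ε` and naturals `2 ≤ U ≤ y`,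
`‖∑_{U < p ≤ y} a_p p^{-σ}‖ ≤ B (log r) U^{-ε} (2 + σ/ε) + B (2/ε + 4σ/ε²)`
(Abel summation with `f(u) = u^{-σ}`: boundary terms `≤ B y^{-ε} log(ry)`, `B U^{-ε} log(rU)`,
integral `≤ Bσ ∫_U^∞ u^{-1-ε} (log r + (2/ε) u^{ε/2}) du`; `y^{-ε} log y ≤ 1/ε`). [folklore] -/
theorem norm_sum_Ioc_prime_mul_rpow_le {a : ℕ → ℂ} {B r ε σ : ℝ} (hB : 0 ≤ B) (hr : 1 ≤ r)
    (hε : 0 < ε) (hσ : 1 / 2 + ε ≤ σ)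
    (hA : ∀ N : ℕ, ‖∑ p ∈ (Finset.Icc 0 N).filter Nat.Prime, a p‖ ≤ B * Real.sqrt N * Real.log (r * N))
    {U y : ℕ} (hU : 2 ≤ U) (hUy : U ≤ y) :
    ‖∑ p ∈ (Finset.Ioc U y).filter Nat.Prime, a p * (((p : ℝ) ^ (-σ) : ℝ) : ℂ)‖ ≤
      B * Real.log r * (U : ℝ) ^ (-ε) * (2 + σ / ε) + B * (2 / ε + 4 * σ / ε ^ 2) := by
  classical
  -- sizes
  have hUr : (2 : ℝ) ≤ U := by exact_mod_cast hU
  have hU0 : (0 : ℝ) < U := by linarith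
  have hUy' : (U : ℝ) ≤ y := by exact_mod_cast hUy
  have hy0 : (0 : ℝ) < y := by linarith
  have hσ0 : 0 < σ := by linarith
  have hlogr : 0 ≤ Real.log r := Real.log_nonneg hr
  have hr0 : 0 < r := by linarith
  -- the players
  set c : ℕ → ℂ := fun k ↦ if k.Prime then a k else 0 with hc
  set f : ℝ → ℂ := fun u ↦ ((u ^ (-σ) : ℝ) : ℂ) with hf
  set f' : ℝ → ℂ := fun u ↦ ((-σ * u ^ (-σ - 1) : ℝ) : ℂ) with hf'
  have hAc : ∀ N : ℕ, ∑ k ∈ Finset.Icc 0 N, c k = ∑ p ∈ (Finset.Icc 0 N).filter Nat.Prime, a p := by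
    intro N; rw [Finset.sum_filter]
  have hfd : ∀ u, 0 < u → HasDerivAt f (f' u) u := fun u hu ↦
    (Real.hasDerivAt_rpow_const (Or.inl hu.ne')).ofReal_comp
  have hdiff : ∀ u ∈ Icc (U : ℝ) y, DifferentiableAt ℝ f u := fun u hu ↦
    (hfd u (hU0.trans_le hu.1)).differentiableAt
  have hf'c : ContinuousOn f' (Icc (U : ℝ) y) :=
    Complex.continuous_ofReal.comp_continuousOn (continuousOn_const.mul
      (fun u hu ↦ (Real.continuousAt_rpow_const u _ (Or.inl (hU0.trans_le hu.1).ne')).continuousWithinAt))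
  have hderiv : EqOn (deriv f) f' (Icc (U : ℝ) y) := fun u hu ↦ (hfd u (hU0.trans_le hu.1)).deriv
  have hint : IntegrableOn (deriv f) (Icc (U : ℝ) y) :=
    hf'c.integrableOn_Icc.congr_fun hderiv.symm measurableSet_Icc
  -- Abel summation
  have hAbel := sum_mul_eq_sub_sub_integral_mul c hU0.le hUy' hdiff hint
  rw [Nat.floor_natCast, Nat.floor_natCast, hAc, hAc] at hAbel
  have hlhs : ∑ k ∈ Finset.Ioc U y, f k * c k =
      ∑ p ∈ (Finset.Ioc U y).filter Nat.Prime, a p * (((p : ℝ) ^ (-σ) : ℝ) : ℂ) := by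
    rw [Finset.sum_filter]
    refine Finset.sum_congr rfl fun k _ ↦ ?_
    simp only [hf, hc]
    split_ifs <;> simp [mul_comm]
  rw [hlhs] at hAbel
  rw [hAbel]
  -- the bound `B N^{1/2 - σ} log(rN) ≤ B (U^{-ε} log r + 1/ε)` for `N ≥ U`
  have hpow : ∀ v : ℝ, (U : ℝ) ≤ v → v ^ (-σ) * Real.sqrt v ≤ v ^ (-ε) ∧ v ^ (-ε) ≤ (U : ℝ) ^ (-ε) ∧
      v ^ (-ε) * Real.log v ≤ 1 / ε := by
    intro v hv
    have hv0 : 0 < v := hU0.trans_le hv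
    have hv1 : 1 ≤ v := by linarith
    refine ⟨?_, Real.rpow_le_rpow_of_nonpos hU0 hv (by linarith), ?_⟩
    · rw [Real.sqrt_eq_rpow, ← Real.rpow_add hv0]
      exact Real.rpow_le_rpow_of_exponent_le hv1 (by linarith)
    · have h1 : Real.log v = (1 / ε) * Real.log (v ^ ε) := by
        rw [Real.log_rpow hv0]; field_simp
      have h2 : Real.log (v ^ ε) ≤ v ^ ε := (Real.log_le_sub_one_of_pos (Real.rpow_pos_of_pos hv0 ε)).trans (by linarith)
      have h3 : v ^ (-ε) * v ^ ε = 1 := by rw [← Real.rpow_add hv0]; simp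
      have h4 : 0 ≤ v ^ (-ε) := Real.rpow_nonneg hv0.le _
      calc v ^ (-ε) * Real.log v = (1 / ε) * (v ^ (-ε) * Real.log (v ^ ε)) := by rw [h1]; ring
        _ ≤ (1 / ε) * (v ^ (-ε) * v ^ ε) := by
            refine mul_le_mul_of_nonneg_left (mul_le_mul_of_nonneg_left h2 h4) (by positivity)
        _ = 1 / ε := by rw [h3, mul_one]
  have hbdry : ∀ N : ℕ, U ≤ N → ‖f N * ∑ p ∈ (Finset.Icc 0 N).filter Nat.Prime, a p‖ ≤
      B * ((U : ℝ) ^ (-ε) * Real.log r + 1 / ε) := by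
    intro N hN
    have hNr : (U : ℝ) ≤ N := by exact_mod_cast hN
    have hN0 : (0 : ℝ) < N := hU0.trans_le hNr
    obtain ⟨h1, h2, h3⟩ := hpow N hNr
    have hlogN : Real.log (r * N) = Real.log r + Real.log N := Real.log_mul hr0.ne' hN0.ne'
    have hlogN0 : 0 ≤ Real.log N := Real.log_nonneg (by linarith)
    rw [norm_mul, hf]
    dsimp only
    rw [Complex.norm_real, Real.norm_of_nonneg (Real.rpow_nonneg hN0.le _)]
    calc (N : ℝ) ^ (-σ) * ‖∑ p ∈ (Finset.Icc 0 N).filter Nat.Prime, a p‖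
        ≤ (N : ℝ) ^ (-σ) * (B * Real.sqrt N * Real.log (r * N)) :=
          mul_le_mul_of_nonneg_left (hA N) (Real.rpow_nonneg hN0.le _)
      _ = B * ((N : ℝ) ^ (-σ) * Real.sqrt N) * (Real.log r + Real.log N) := by rw [hlogN]; ring
      _ ≤ B * (N : ℝ) ^ (-ε) * (Real.log r + Real.log N) := by
          refine mul_le_mul_of_nonneg_right (mul_le_mul_of_nonneg_left h1 hB) (by positivity)
      _ = B * ((N : ℝ) ^ (-ε) * Real.log r + (N : ℝ) ^ (-ε) * Real.log N) := by ring
      _ ≤ B * ((U : ℝ) ^ (-ε) * Real.log r + 1 / ε) := by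
          refine mul_le_mul_of_nonneg_left (add_le_add ?_ h3) hB
          exact mul_le_mul_of_nonneg_right h2 hlogr
  -- the integral
  have hI : ‖∫ u in Ioc (U : ℝ) y, deriv f u * ∑ k ∈ Finset.Icc 0 ⌊u⌋₊, c k‖ ≤
      B * σ * (Real.log r * (U : ℝ) ^ (-ε) / ε + 4 / ε ^ 2) := by
    rw [← intervalIntegral.integral_of_le hUy']
    -- pointwise bound by `g u = B σ (log r · u^{-1-ε} + (2/ε) u^{-1-ε/2})`
    have hbound : ∀ᵐ u : ℝ, u ∈ Ioc (U : ℝ) y → ‖deriv f u * ∑ k ∈ Finset.Icc 0 ⌊u⌋₊, c k‖ ≤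
        B * σ * (Real.log r * u ^ (-1 - ε) + 2 / ε * u ^ (-1 - ε / 2)) := by
      refine ae_of_all _ fun u hu ↦ ?_
      have hUu : (U : ℝ) ≤ u := hu.1.le
      have hu0 : 0 < u := hU0.trans_le hUu
      have hu1 : 1 ≤ u := by linarith
      rw [hderiv (Ioc_subset_Icc_self hu), hAc, norm_mul, hf']
      dsimp only
      rw [Complex.norm_real, Real.norm_eq_abs, abs_mul, abs_neg, abs_of_pos hσ0,
        abs_of_nonneg (Real.rpow_nonneg hu0.le _)]
      -- `‖A(⌊u⌋)‖ ≤ B √u log(ru)`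
      have hfl0 : (U : ℝ) ≤ ⌊u⌋₊ := by exact_mod_cast Nat.le_floor hUu
      have hfl1 : (0 : ℝ) < ⌊u⌋₊ := hU0.trans_le hfl0
      have hflu : (⌊u⌋₊ : ℝ) ≤ u := Nat.floor_le hu0.le
      have hAu : ‖∑ p ∈ (Finset.Icc 0 ⌊u⌋₊).filter Nat.Prime, a p‖ ≤ B * Real.sqrt u * Real.log (r * u) := by
        refine (hA ⌊u⌋₊).trans ?_
        have h1 : Real.sqrt ⌊u⌋₊ ≤ Real.sqrt u := Real.sqrt_le_sqrt hflu
        have h2 : Real.log (r * ⌊u⌋₊) ≤ Real.log (r * u) :=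
          Real.log_le_log (by positivity) (mul_le_mul_of_nonneg_left hflu hr0.le)
        have h20 : 0 ≤ Real.log (r * ⌊u⌋₊) :=
          Real.log_nonneg (one_le_mul_of_one_le_of_one_le hr (by linarith))
        exact mul_le_mul (mul_le_mul_of_nonneg_left h1 hB) h2 h20 (by positivity)
      -- `σ u^{-σ-1} √u ≤ σ u^{-1-ε}` and `log(ru) ≤ log r + (2/ε) u^{ε/2}`
      have hp1 : u ^ (-σ - 1) * Real.sqrt u ≤ u ^ (-1 - ε) := by
        rw [Real.sqrt_eq_rpow, ← Real.rpow_add hu0]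
        exact Real.rpow_le_rpow_of_exponent_le hu1 (by linarith)
      have hlogu : Real.log u ≤ 2 / ε * u ^ (ε / 2) := by
        have h1 : Real.log u = (2 / ε) * Real.log (u ^ (ε / 2)) := by
          rw [Real.log_rpow hu0]; field_simp
        rw [h1]
        refine mul_le_mul_of_nonneg_left ?_ (by positivity)
        exact (Real.log_le_sub_one_of_pos (Real.rpow_pos_of_pos hu0 _)).trans (by linarith)
      have hlogru : Real.log (r * u) ≤ Real.log r + 2 / ε * u ^ (ε / 2) := by
        rw [Real.log_mul hr0.ne' hu0.ne']; linarith
      have hlogru0 : 0 ≤ Real.log (r * u) := Real.log_nonneg (one_le_mul_of_one_le_of_one_le hr hu1)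
      have hpow2 : u ^ (-1 - ε) * u ^ (ε / 2) = u ^ (-1 - ε / 2) := by
        rw [← Real.rpow_add hu0]; ring_nf
      calc σ * u ^ (-σ - 1) * ‖∑ p ∈ (Finset.Icc 0 ⌊u⌋₊).filter Nat.Prime, a p‖
          ≤ σ * u ^ (-σ - 1) * (B * Real.sqrt u * Real.log (r * u)) :=
            mul_le_mul_of_nonneg_left hAu (by positivity)
        _ = B * σ * (u ^ (-σ - 1) * Real.sqrt u) * Real.log (r * u) := by ring
        _ ≤ B * σ * u ^ (-1 - ε) * (Real.log r + 2 / ε * u ^ (ε / 2)) :=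
            mul_le_mul (mul_le_mul_of_nonneg_left hp1 (by positivity)) hlogru hlogru0 (by positivity)
        _ = B * σ * (Real.log r * u ^ (-1 - ε) + 2 / ε * (u ^ (-1 - ε) * u ^ (ε / 2))) := by ring
        _ = B * σ * (Real.log r * u ^ (-1 - ε) + 2 / ε * u ^ (-1 - ε / 2)) := by rw [hpow2]
    -- the majorant is integrable, with a small integral
    have h0U : (0 : ℝ) ∉ uIcc (U : ℝ) y := by
      rw [uIcc_of_le hUy']; exact fun h ↦ lt_irrefl (0 : ℝ) (hU0.trans_le h.1)
    have hi1 : IntervalIntegrable (fun u : ℝ ↦ u ^ (-1 - ε)) volume U y :=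
      intervalIntegral.intervalIntegrable_rpow (Or.inr h0U)
    have hi2 : IntervalIntegrable (fun u : ℝ ↦ u ^ (-1 - ε / 2)) volume U y :=
      intervalIntegral.intervalIntegrable_rpow (Or.inr h0U)
    have hgi : IntervalIntegrable (fun u : ℝ ↦ B * σ * (Real.log r * u ^ (-1 - ε) + 2 / ε * u ^ (-1 - ε / 2)))
        volume U y := ((hi1.const_mul _).add (hi2.const_mul _)).const_mul _
    have hI1 : ∫ u in (U : ℝ)..y, u ^ (-1 - ε) ≤ (U : ℝ) ^ (-ε) / ε := by
      rw [integral_rpow (Or.inr ⟨by linarith, h0U⟩)]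
      have e : -1 - ε + 1 = -ε := by ring
      rw [e, div_neg, neg_div', neg_sub]
      have h1 : 0 ≤ (y : ℝ) ^ (-ε) := Real.rpow_nonneg hy0.le _
      exact div_le_div_of_nonneg_right (by linarith) hε.le
    have hI2 : ∫ u in (U : ℝ)..y, u ^ (-1 - ε / 2) ≤ 2 / ε := by
      rw [integral_rpow (Or.inr ⟨by linarith, h0U⟩)]
      have e : -1 - ε / 2 + 1 = -(ε / 2) := by ring
      rw [e, div_neg, neg_div', neg_sub]
      have h1 : 0 ≤ (y : ℝ) ^ (-(ε / 2)) := Real.rpow_nonneg hy0.le _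
      have h2 : (U : ℝ) ^ (-(ε / 2)) ≤ 1 := Real.rpow_le_one_of_one_le_of_nonpos (by linarith) (by linarith)
      rw [div_le_div_iff₀ (by positivity) hε]
      nlinarith
    have hIg : ∫ u in (U : ℝ)..y, B * σ * (Real.log r * u ^ (-1 - ε) + 2 / ε * u ^ (-1 - ε / 2)) ≤
        B * σ * (Real.log r * (U : ℝ) ^ (-ε) / ε + 4 / ε ^ 2) := by
      rw [intervalIntegral.integral_const_mul, intervalIntegral.integral_add (hi1.const_mul _)
        (hi2.const_mul _), intervalIntegral.integral_const_mul, intervalIntegral.integral_const_mul]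
      refine mul_le_mul_of_nonneg_left ?_ (by positivity)
      calc Real.log r * (∫ u in (U : ℝ)..y, u ^ (-1 - ε)) + 2 / ε * ∫ u in (U : ℝ)..y, u ^ (-1 - ε / 2)
          ≤ Real.log r * ((U : ℝ) ^ (-ε) / ε) + 2 / ε * (2 / ε) :=
            add_le_add (mul_le_mul_of_nonneg_left hI1 hlogr) (mul_le_mul_of_nonneg_left hI2 (by positivity))
        _ = Real.log r * (U : ℝ) ^ (-ε) / ε + 4 / ε ^ 2 := by field_simp; ring
    exact (intervalIntegral.norm_integral_le_of_norm_le hUy' hbound hgi).trans hIg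
  -- assembly
  have e1 := norm_sub_le (f y * ∑ p ∈ (Finset.Icc 0 y).filter Nat.Prime, a p -
      f U * ∑ p ∈ (Finset.Icc 0 U).filter Nat.Prime, a p)
    (∫ u in Ioc (U : ℝ) y, deriv f u * ∑ k ∈ Finset.Icc 0 ⌊u⌋₊, c k)
  have e2 := norm_sub_le (f y * ∑ p ∈ (Finset.Icc 0 y).filter Nat.Prime, a p)
    (f U * ∑ p ∈ (Finset.Icc 0 U).filter Nat.Prime, a p)
  have hby := hbdry y hUy
  have hbU := hbdry U le_rfl
  have halg : B * ((U : ℝ) ^ (-ε) * Real.log r + 1 / ε) + B * ((U : ℝ) ^ (-ε) * Real.log r + 1 / ε) +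
      B * σ * (Real.log r * (U : ℝ) ^ (-ε) / ε + 4 / ε ^ 2) =
      B * Real.log r * (U : ℝ) ^ (-ε) * (2 + σ / ε) + B * (2 / ε + 4 * σ / ε ^ 2) := by
    field_simp; ring
  linarith

end GRHTwistedPrimeSum

end Literature.NumberTheory.LFunctions
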